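import Mathlib
import Literature.NumberTheory.Sieve.Maynard2016Lemma7RadLcm
import Literature.NumberTheory.Sieve.Maynard2016Lemma7ErrorFinal
import Literature.NumberTheory.Sieve.Maynard2016Lemma7System
import Literature.NumberTheory.Sieve.Maynard2016CoupledBoxW
import HarnessLib

/-!
# Maynard (2016), Lemma 7: the main term `S_i` as a combination of `φ`-weighted coupled sums

Topic `Literature/NumberTheory/Sieve`; trunk AntSieve / parity (Maynard 2016 large-gaps ladder, named
fact `Literature.NumberTheory.Sieve.Maynard2016.Lemma7Tuple` of `Maynard2016Lemma7PerTuple.lean`).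

J. Maynard, *Large gaps between primes*, Ann. of Math. (2) 183 (2016), 915–933 = arXiv:1408.5110,
§6, proof of Lemma 7, display (6.32): "By an argument analogous to that of Lemma 6 we see that …
the main term is …".  The analogue of `Maynard2016MainSumLink` (display (6.8) expanded) for Lemma 7:
the main term `S_i = Maynard2016.solvSum` of the error-term split
(`Maynard2016Lemma7ErrorFinal.exists_eventually_abs_sum_divSum_sq_sub_le`) is, after substituting the
definition (5.3) of `λ_{d,e}` and expanding, the combination
`Σ_j Σ_{j'} c_j c_{j'} Σ_{(d,d',e,e') ∈ rbox⁴} [CoupledAdm (P_w) m (couplingSet7 p₀ i)] ·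
  coupledLcmTermW (1/φ) (F_{·,j}) (F_{·,j'}) G G x y (d,d') (e,e')`
of the `φ`-WEIGHTED coupled terms of `Maynard2016CoupledBoxW` (denominator weight
`phiInv = 1/φ`, an admissible `LcmEuler.IsLcmWeight` with `|1/φ(n)| ≤ 1`), whose kernel representation
is `LcmEuler.coupledLcmSumW_eq_integral_freqKernel`.  (The sum is still over `rbox k x i`, i.e. with the
trivial slot `i`; re-indexing to the `k − 1` non-trivial slots is left to the main-term proof.)

* `phiInv`, `isLcmWeight_phiInv`, `norm_phiInv_le_one`;
* `ofReal_lam_mul_lam_mul_phiInv` — `λ_{d,e} λ_{d',e'} · φ([d,d',e,e'])⁻¹ = Σ_j Σ_{j'} c_j c_{j'} ·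
  coupledLcmTermW phiInv …`;
* `ofReal_solvSum_summand_eq`, **`ofReal_solvSum_eq`** — the expansion of `S_i`.

## References

* J. Maynard, *Large gaps between primes*, Ann. of Math. (2) 183 (2016), 915–933; arXiv:1408.5110,
  §5 display (5.3), §6 displays (6.8), (6.32). [Maynard2016LargeGaps]
-/

noncomputable section

open Filter Finset
open scoped BigOperators Topology ArithmeticFunction.Moebius Classical

namespace Literature.NumberTheory.Sieve

namespace Maynard2016

open LcmEuler

variable {k J : ℕ}

/-! ### The weight `1/φ` -/

/-- The denominator weight `n ↦ 1/φ(n)` of Lemma 7's main term. [cite: Maynard2016LargeGaps, §6 display (6.32)] -/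
def phiInv : ℕ → ℂ := fun n => ((Nat.totient n : ℕ) : ℂ)⁻¹

/-- `1/φ` is an admissible denominator weight (Polymath 8b, Lemma 4.1, last paragraph of the proof).
[cite: Polymath8b2014, Lemma 4.1] -/
theorem isLcmWeight_phiInv : IsLcmWeight phiInv := isLcmWeight_totient_inv

/-- `|1/φ(n)| ≤ 1`. [cite: Maynard2016LargeGaps, §6 display (6.32)] -/
theorem norm_phiInv_le_one (n : ℕ) : ‖phiInv n‖ ≤ 1 := by
  unfold phiInv
  rw [norm_inv, Complex.norm_natCast]
  rcases Nat.eq_zero_or_pos (Nat.totient n) with h | h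
  · simp [h]
  · exact inv_le_one_of_one_le₀ (by exact_mod_cast h)

/-- `a / φ(L) = a · phiInv L` (as complex numbers). [cite: Maynard2016LargeGaps, §6 display (6.32)] -/
theorem ofReal_div_totient (a : ℝ) (L : ℕ) :
    (((a / (Nat.totient L : ℝ)) : ℝ) : ℂ) = (a : ℂ) * phiInv L := by
  unfold phiInv
  push_cast
  rw [div_eq_mul_inv]

/-! ### Expanding `λ_{d,e} λ_{d',e'}` -/

/-- Rearranging the eight products of one `(j, j')`-term. [folklore] -/
private theorem prod_rearrange_mul {ι : Type*} [Fintype ι] (c c' L : ℂ)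
    (a₁ a₂ a₃ a₄ a₅ a₆ a₇ a₈ : ι → ℂ) :
    (∏ i, a₁ i * a₂ i) * (c * ∏ i, a₃ i * a₄ i) * ((∏ i, a₅ i * a₆ i) * (c' * ∏ i, a₇ i * a₈ i)) * L =
      c * c' * ((∏ i, a₁ i * a₅ i * a₃ i * a₇ i) * (∏ i, a₂ i * a₆ i * a₄ i * a₈ i) * L) := by
  have h : (∏ i, a₁ i * a₂ i) * (∏ i, a₃ i * a₄ i) * ((∏ i, a₅ i * a₆ i) * ∏ i, a₇ i * a₈ i) =
      (∏ i, a₁ i * a₅ i * a₃ i * a₇ i) * ∏ i, a₂ i * a₆ i * a₄ i * a₈ i := by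
    simp only [← Finset.prod_mul_distrib]
    exact Finset.prod_congr rfl fun i _ => by ring
  calc (∏ i, a₁ i * a₂ i) * (c * ∏ i, a₃ i * a₄ i) * ((∏ i, a₅ i * a₆ i) * (c' * ∏ i, a₇ i * a₈ i)) * L
      = c * c' * ((∏ i, a₁ i * a₂ i) * (∏ i, a₃ i * a₄ i) *
          ((∏ i, a₅ i * a₆ i) * ∏ i, a₇ i * a₈ i) * L) := by ring
    _ = _ := by rw [h]

/-- **Substituting (5.3) and expanding**: `λ_{d,e} λ_{d',e'} · φ([d,d',e,e'])⁻¹ =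
Σ_j Σ_{j'} c_j c_{j'} · coupledLcmTermW phiInv (F_{·,j}) (F_{·,j'}) G G x y (d,d') (e,e')`.
[cite: Maynard2016LargeGaps, §6 displays (6.8), (6.32)] -/
theorem ofReal_lam_mul_lam_mul_phiInv (c : Fin J → ℝ) (Fd : Fin k → Fin J → ℝ → ℝ) (G : ℝ → ℝ)
    (ε : ℝ) (x : ℕ) (d d' e e' : Fin k → ℕ) :
    (lam c Fd G ε x d e : ℂ) * (lam c Fd G ε x d' e' : ℂ) *
        phiInv (Nat.lcm (∏ i, Nat.lcm (d i) (d' i)) (∏ i, Nat.lcm (e i) (e' i))) =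
      ∑ j, ∑ j', (c j : ℂ) * c j' *
        coupledLcmTermW phiInv (fun ℓ => Fd ℓ j) (fun ℓ => Fd ℓ j') (fun _ : Fin k => G) (fun _ => G)
          (x : ℝ) (y ε x) (d, d') (e, e') := by
  rw [lam, lam]
  push_cast
  rw [Finset.mul_sum, Finset.mul_sum, Finset.sum_mul, Finset.sum_mul]
  refine Finset.sum_congr rfl fun j _ => ?_
  rw [Finset.mul_sum, Finset.sum_mul]
  refine Finset.sum_congr rfl fun j' _ => ?_
  rw [coupledLcmTermW]
  exact prod_rearrange_mul _ _ _ _ _ _ _ _ _ _ _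

/-! ### The main term `S_i` as a combination of weighted coupled sums -/

/-- **One summand of `S_i`**: for `d, d', e, e'` in the restricted box and large `x`
(`x < p₀`, `(m p₀ − 1, P_y) = 1`, prime factors of the `h_b − h_a` divide `P_w`),
`[SysSolvable] λλ'/φ(radMod) = [CoupledAdm (P_w) m (couplingSet7 p₀ i)] Σ_j Σ_{j'} c_j c_{j'} ·
coupledLcmTermW phiInv …` (both sides vanish off the support of `λ_{d,e} λ_{d',e'}`, on which all moduli are
squarefree and `summand_sysSolvable_eq_coupledAdm` applies). [cite: Maynard2016LargeGaps, §6 display (6.32)] -/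
theorem ofReal_solvSum_summand_eq {c : Fin J → ℝ} {Fd : Fin k → Fin J → ℝ → ℝ} {G : ℝ → ℝ}
    (hD : IsSieveData k J c Fd G) {ε : ℝ} {x : ℕ} (hx1 : 1 ≤ x) (hlogx : 0 < Real.log x)
    (hlogy : 0 < Real.log (y ε x)) {m p₀ : ℕ} (hp₀ : p₀.Prime) (hm : 1 ≤ m) (hxp : x < p₀)
    (hcop : Nat.Coprime (m * p₀ - 1) (primorial ⌊y ε x⌋₊))
    (hW : ∀ a b : Fin k, a ≠ b → ∀ p : ℕ, p.Prime →
      (p : ℤ) ∣ (hTuple k x b : ℤ) - hTuple k x a → p ∣ Pw x)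
    {i : Fin k} {d d' e e' : Fin k → ℕ} (hd : d ∈ rbox k x i) (hd' : d' ∈ rbox k x i)
    (he : e ∈ rbox k x i) (he' : e' ∈ rbox k x i) :
    (((if SysSolvable k x m p₀ i d d' e e' then
        lam c Fd G ε x d e * lam c Fd G ε x d' e' / (Nat.totient (radMod d d' e e') : ℝ)
      else 0 : ℝ)) : ℂ) =
      if CoupledAdm (Pw x) m (couplingSet7 k x m p₀ i) (d, d') (e, e') then
        ∑ j, ∑ j', (c j : ℂ) * c j' *
          coupledLcmTermW phiInv (fun ℓ => Fd ℓ j) (fun ℓ => Fd ℓ j') (fun _ : Fin k => G)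
            (fun _ => G) (x : ℝ) (y ε x) (d, d') (e, e')
      else 0 := by
  rw [← ofReal_lam_mul_lam_mul_phiInv]
  by_cases hlam : lam c Fd G ε x d e * lam c Fd G ε x d' e' = 0
  · -- both sides vanish
    rw [hlam, zero_div, ite_self, ← Complex.ofReal_mul, hlam]
    push_cast
    simp
  · have h1 : lam c Fd G ε x d e ≠ 0 := left_ne_zero_of_mul hlam
    have h2 : lam c Fd G ε x d' e' ≠ 0 := right_ne_zero_of_mul hlam
    obtain ⟨hdb, hdi⟩ := mem_rbox.1 hd
    obtain ⟨hdb', hdi'⟩ := mem_rbox.1 hd'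
    obtain ⟨heb, hei⟩ := mem_rbox.1 he
    obtain ⟨heb', hei'⟩ := mem_rbox.1 he'
    obtain ⟨hsd, hsd', hse, hse', hdlt, hecop⟩ :=
      support_hyps_of_lam_ne_zero hD hx1 hlogx hlogy hxp hcop hdb hdb' heb heb' h1 h2
    rw [summand_sysSolvable_eq_coupledAdm hp₀ hm hW hsd hsd' hse hse' hdlt hecop hdi hdi' hei hei']
    split_ifs
    · rw [ofReal_div_totient]
      push_cast
      rfl
    · push_cast
      rfl

/-- **`S_i` expanded (Lemma 7's (6.8))**: for large `x` (`x < p₀` prime, `(m p₀ − 1, P_y) = 1`, prime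
factors of the `h_b − h_a` divide `P_w`),
`S_i = Σ_{(d,d',e,e') ∈ rbox⁴} [CoupledAdm (P_w) m (couplingSet7 p₀ i) (d,d') (e,e')] ·
  Σ_j Σ_{j'} c_j c_{j'} coupledLcmTermW phiInv (F_{·,j}) (F_{·,j'}) G G x y (d,d') (e,e')`.
[cite: Maynard2016LargeGaps, §6 display (6.32)] -/
theorem ofReal_solvSum_eq {c : Fin J → ℝ} {Fd : Fin k → Fin J → ℝ → ℝ} {G : ℝ → ℝ}
    (hD : IsSieveData k J c Fd G) {ε : ℝ} {x : ℕ} (hx1 : 1 ≤ x) (hlogx : 0 < Real.log x)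
    (hlogy : 0 < Real.log (y ε x)) {m p₀ : ℕ} (hp₀ : p₀.Prime) (hm : 1 ≤ m) (hxp : x < p₀)
    (hcop : Nat.Coprime (m * p₀ - 1) (primorial ⌊y ε x⌋₊))
    (hW : ∀ a b : Fin k, a ≠ b → ∀ p : ℕ, p.Prime →
      (p : ℤ) ∣ (hTuple k x b : ℤ) - hTuple k x a → p ∣ Pw x) (i : Fin k) :
    ((solvSum c Fd G ε x m p₀ i : ℝ) : ℂ) =
      ∑ d ∈ rbox k x i, ∑ d' ∈ rbox k x i, ∑ e ∈ rbox k x i, ∑ e' ∈ rbox k x i,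
        if CoupledAdm (Pw x) m (couplingSet7 k x m p₀ i) (d, d') (e, e') then
          ∑ j, ∑ j', (c j : ℂ) * c j' *
            coupledLcmTermW phiInv (fun ℓ => Fd ℓ j) (fun ℓ => Fd ℓ j') (fun _ : Fin k => G)
              (fun _ => G) (x : ℝ) (y ε x) (d, d') (e, e')
        else 0 := by
  unfold solvSum
  push_cast
  refine Finset.sum_congr rfl fun d hd => Finset.sum_congr rfl fun d' hd' =>
    Finset.sum_congr rfl fun e he => Finset.sum_congr rfl fun e' he' => ?_
  exact ofReal_solvSum_summand_eq hD hx1 hlogx hlogy hp₀ hm hxp hcop hW hd hd' he he'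

/-- **`S_i` as a combination of weighted coupled sums** (the `j`-sums outside):
`S_i = Σ_j Σ_{j'} c_j c_{j'} · Σ_{rbox⁴} [CoupledAdm …] coupledLcmTermW phiInv (F_{·,j}) (F_{·,j'}) G G …`.
[cite: Maynard2016LargeGaps, §6 display (6.32)] -/
theorem ofReal_solvSum_eq_sum {c : Fin J → ℝ} {Fd : Fin k → Fin J → ℝ → ℝ} {G : ℝ → ℝ}
    (hD : IsSieveData k J c Fd G) {ε : ℝ} {x : ℕ} (hx1 : 1 ≤ x)
    (hlogx : 0 < Real.log x) (hlogy : 0 < Real.log (y ε x)) {m p₀ : ℕ} (hp₀ : p₀.Prime)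
    (hm : 1 ≤ m) (hxp : x < p₀) (hcop : Nat.Coprime (m * p₀ - 1) (primorial ⌊y ε x⌋₊))
    (hW : ∀ a b : Fin k, a ≠ b → ∀ p : ℕ, p.Prime →
      (p : ℤ) ∣ (hTuple k x b : ℤ) - hTuple k x a → p ∣ Pw x) (i : Fin k) :
    ((solvSum c Fd G ε x m p₀ i : ℝ) : ℂ) =
      ∑ j, ∑ j', (c j : ℂ) * c j' *
        ∑ d ∈ rbox k x i, ∑ d' ∈ rbox k x i, ∑ e ∈ rbox k x i, ∑ e' ∈ rbox k x i,
          if CoupledAdm (Pw x) m (couplingSet7 k x m p₀ i) (d, d') (e, e') then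
            coupledLcmTermW phiInv (fun ℓ => Fd ℓ j) (fun ℓ => Fd ℓ j') (fun _ : Fin k => G)
              (fun _ => G) (x : ℝ) (y ε x) (d, d') (e, e')
          else 0 := by
  rw [ofReal_solvSum_eq hD hx1 hlogx hlogy hp₀ hm hxp hcop hW i]
  -- push the `(j, j')`-sums inside, one box-sum at a time
  have key : ∀ (s : Finset (Fin k → ℕ)) (T : Fin J → Fin J → (Fin k → ℕ) → ℂ),
      ∑ j, ∑ j', (c j : ℂ) * c j' * ∑ v ∈ s, T j j' v =
        ∑ v ∈ s, ∑ j, ∑ j', (c j : ℂ) * c j' * T j j' v := by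
    intro s T
    calc ∑ j, ∑ j', (c j : ℂ) * c j' * ∑ v ∈ s, T j j' v
        = ∑ j, ∑ j', ∑ v ∈ s, (c j : ℂ) * c j' * T j j' v := by simp_rw [Finset.mul_sum]
      _ = ∑ j, ∑ v ∈ s, ∑ j', (c j : ℂ) * c j' * T j j' v :=
          Finset.sum_congr rfl fun j _ => Finset.sum_comm
      _ = ∑ v ∈ s, ∑ j, ∑ j', (c j : ℂ) * c j' * T j j' v := Finset.sum_comm
  symm
  rw [key]
  refine Finset.sum_congr rfl fun d _ => ?_
  rw [key]
  refine Finset.sum_congr rfl fun d' _ => ?_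
  rw [key]
  refine Finset.sum_congr rfl fun e _ => ?_
  rw [key]
  refine Finset.sum_congr rfl fun e' _ => ?_
  split_ifs
  · rfl
  · simp

end Maynard2016

end Literature.NumberTheory.Sieve

end
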